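import Summits.ABC.StewartYu.ArchG3RecEndB
import Summits.ABC.StewartYu.RecordExitCCapped
import HarnessLib

/-!
# The archimedean record of reference `ArchG3Rec` — exit C (the covolume clause (C) of `RecordArchW`) on the capped letters

Support file (elementary theorems; no named facts, no new definitions). Cell `abc-stewartyu`, route `YuMatveevShapeRat`,
crux r2 `ArchCoreRat` (stmt-ABC-20502; plan R41 — the capped END exits; p1 memo `ArchG3Rec-END-capped` §(C), taken by
p4 g10 as parcel (r2-c), STATUS 2026-08-27T20:15Z/20:26Z). Instantiation of the generic
`RecordExits.exitC_capped` (`RecordExitCCapped.lean`) at the letters of `P : ArchG3Rec n`: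

* `two_pow_le_CbK` — `2^{n+18} ≤ C_bⁿ·K` (`C_b ≥ 64`, `K ≥ n·e^{8(n+1)+2} ≥ 2^{8n+10}`);
* `three_L_le` — the END floor of the range, `3(n+1)L ≤ 2·(C_bⁿK)·X·Ω` (`X ≥ (3/2)(n+1)L/(C_bⁿΩK)`);
* `D₀_le_XKΩ` — `D₀ ≤ 8X·(C_bⁿK)·Ω` (`D₀ = L₀ + 1`, `L₀ < 6XC_bⁿΩK/N + 1`, `N ≥ 1`);
* `exitC` — clause (C) of `RecordArchW (c^·) Y n P.A P.D₀ P.S₀ P.Xfin P.D` at the slack function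
  `Y = RecordExits.Yslack (C_bⁿK) n` (for `n ≥ 2`; the constant `c` does not enter clause (C)).

WHAT THIS IS NOT: not clause (N) (numerics, sequel `ArchG3RecEndCNum`), not the assembly of `RecordArchW`
(`ArchG3RecordW`); no crux moves.

## References
* [Nesterenko2003] Yu. V. Nesterenko, LNM 1819 (2003) — §5.2 (5.13), (5.19)–(5.22), Lemmas 5.3–5.4.
* [Matveev2000] E. M. Matveev, Izv. Math. 64 (2000) — (1.3).
-/

noncomputable section

open Finset Real
open Literature.NumberTheory.Transcendental
open Literature.NumberTheory.Transcendental.GaGm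

namespace Summit.ABC.StewartYu

namespace ArchG3Rec

open PadicG3Par (Cb Cb_pos sixtyfour_le_Cb)
open ArchG3Par (G K G_eq G_pos one_le_K K_pos mul_exp_le_K)

variable {n : ℕ} (P : ArchG3Rec n)

/-! ### The constant `c_K = C_bⁿ·K` -/

/-- `K ≥ 2^{8n+10}` (`K ≥ n·e^{8(n+1)+2}`, `e ≥ 2`, `n ≥ 1`). [folklore] -/
theorem two_pow_le_K (hn : 1 ≤ n) : (2 : ℝ) ^ (8 * n + 10) ≤ K n := by
  have h1 := mul_exp_le_K n
  have hn1 : (1 : ℝ) ≤ n := by exact_mod_cast hn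
  have he : Real.exp (G n + 2) = Real.exp 1 ^ (8 * n + 10) := by
    rw [G_eq, Real.exp_one_pow]; congr 1; push_cast; ring
  have h2 : (2 : ℝ) ^ (8 * n + 10) ≤ Real.exp 1 ^ (8 * n + 10) :=
    pow_le_pow_left₀ (by norm_num) (by linarith [Real.exp_one_gt_d9]) _
  have h3 : Real.exp 1 ^ (8 * n + 10) ≤ (n : ℝ) * Real.exp 1 ^ (8 * n + 10) :=
    le_mul_of_one_le_left (by positivity) hn1
  rw [he] at h1
  linarith

/-- **`2^{n+18} ≤ C_bⁿ·K`** (`C_b ≥ 64`, `K ≥ 2^{8n+10}`, `n ≥ 1`). [folklore] -/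
theorem two_pow_le_CbK (hn : 1 ≤ n) : (2 : ℝ) ^ (n + 18) ≤ Cb ^ n * K n := by
  have h64 : (64 : ℝ) ^ n ≤ Cb ^ n := pow_le_pow_left₀ (by norm_num) sixtyfour_le_Cb n
  have hK := two_pow_le_K hn
  have e64 : (64 : ℝ) ^ n = 2 ^ (6 * n) := by rw [pow_mul]; norm_num
  have h1 : (2 : ℝ) ^ (n + 18) ≤ 2 ^ (6 * n) * 2 ^ (8 * n + 10) := by
    rw [← pow_add]; exact pow_le_pow_right₀ (by norm_num) (by omega)
  rw [← e64] at h1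
  exact h1.trans (mul_le_mul h64 hK (by positivity) (pow_pos Cb_pos n).le)

/-! ### The two `Ω`-floors used by the light selections -/

/-- **the END floor of the range**: `3(n+1)L ≤ 2·(C_bⁿK)·X·Ω` (`X ≥ (3/2)(n+1)L/(C_bⁿΩK)`).
[cite: Nesterenko2003, Prop 3.9 (3.25); shape only] -/
theorem three_L_le : 3 * ((n : ℝ) + 1) * P.L ≤ 2 * (Cb ^ n * K n) * P.X * ∏ j, P.A j := by
  have h := P.X_floors.2.2.2
  have hΩ : 0 < P.Ω := P.Ω_facts.1
  have hpos : 0 < Cb ^ n * P.Ω * K n := by have := K_pos n; have := Cb_pos; positivity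
  rw [div_le_iff₀ hpos] at h
  have e : P.Ω = ∏ j, P.A j := rfl
  rw [← e]; nlinarith

/-- **`D₀ ≤ 8X·(C_bⁿK)·Ω`** (`D₀ = L₀ + 1 < 6XC_bⁿΩK/N + 2 ≤ 8XC_bⁿKΩ` as `N ≥ 1`, `XC_bⁿKΩ ≥ 1`).
[cite: Nesterenko2003, §5.2 (5.16); shape only] -/
theorem D₀_le_XKΩ : (P.D₀ : ℝ) ≤ 8 * P.X * (Cb ^ n * K n) * ∏ j, P.A j := by
  have h1 := P.L₀_lt
  obtain ⟨hΩ0, hΩ1, -, -⟩ := P.Ω_facts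
  obtain ⟨hN0, hN1, -⟩ := P.N_facts
  have hX := P.X_floors.2.1
  have hK1 : (1 : ℝ) ≤ K n := by exact_mod_cast one_le_K n
  have hCb1 : (1 : ℝ) ≤ Cb ^ n := one_le_pow₀ (by linarith [sixtyfour_le_Cb])
  have e : P.Ω = ∏ j, P.A j := rfl
  rw [← e]
  have hcore : 0 ≤ 6 * (P.X : ℝ) * Cb ^ n * P.Ω * K n := by positivity
  -- `6XC_bⁿΩK/N ≤ 6XC_bⁿΩK`
  have h2 : 6 * (P.X : ℝ) * Cb ^ n * P.Ω * K n / P.N ≤ 6 * P.X * Cb ^ n * P.Ω * K n :=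
    div_le_self hcore hN1
  -- `1 ≤ XC_bⁿKΩ`
  have h3 : (1 : ℝ) ≤ (P.X : ℝ) * (Cb ^ n * K n) * P.Ω := by
    have hX1 : (1 : ℝ) ≤ P.X := by linarith
    exact one_le_mul_of_one_le_of_one_le (one_le_mul_of_one_le_of_one_le hX1
      (one_le_mul_of_one_le_of_one_le hCb1 hK1)) hΩ1
  have hD : (P.D₀ : ℝ) = (P.L₀ : ℝ) + 1 := by unfold D₀; push_cast; ring
  rw [hD]
  nlinarith

/-! ### Clause (C) -/

/-- **Exit C for `ArchG3Rec` (`n ≥ 2`)**: clause (C) of `RecordArchW` — for `0 < r < n`, `d₀ ≤ 1`, every `r × n` integer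
matrix with independent rows satisfying the exit-C inequality at the letters `(D₀, S₀, X_fin, D)`, and every injective
non-singular column selection `κ`, the covolume clause `(r!)²nʳ·(|det M_κ|·∏ᵢ A(κ i))·Y r ≤ Ω` at the slack function
`Y = RecordExits.Yslack (C_bⁿK) n`. [cite: Nesterenko2003, §5.2 (5.13), (5.19)–(5.22)] -/
theorem exitC (hn2 : 2 ≤ n) :
    ∀ (r d₀ : ℕ) (M : Matrix (Fin r) (Fin n) ℤ), 0 < r → r < n → d₀ ≤ 1 →
      LinearIndependent ℤ (fun i => M i) →
      Nat.choose (P.S₀ + (r - d₀)) (r - d₀) * (2 * P.Xfin + 1) * nesterenkoH n r d₀ M P.D₀ P.D ≤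
          (n + 1).factorial * 2 ^ n * P.D₀ * ∏ j, P.D j →
      ∀ κ : Fin r → Fin n, Function.Injective κ →
        (Matrix.of fun i j => (M j (κ i) : ℝ)).det ≠ 0 →
        ((r.factorial : ℝ)) ^ 2 * (n : ℝ) ^ r *
            (|(Matrix.of fun i j => (M j (κ i) : ℝ)).det| * ∏ i, P.A (κ i)) *
          RecordExits.Yslack (Cb ^ n * K n) n r ≤ ∏ j, P.A j := by
  obtain ⟨hD, hρ2, hρ⟩ := P.rho_facts
  obtain ⟨hL1, hL0, h25, -⟩ := P.L_real
  have hA1 : ∀ j, 1 ≤ P.A j := fun j => (P.A_facts j).2.1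
  have hD1 : ∀ j, 1 ≤ P.D j := P.end_floors.2.1
  have hX64 : 64 * ((n : ℝ) + 1) ≤ P.X := by exact_mod_cast P.X_floors.1
  have hX1 : (1 : ℝ) ≤ P.X := by linarith [P.X_floors.2.1]
  have hD₀half : (P.D₀ : ℝ) ≤ (P.X : ℝ) * P.L / 2 := by
    have h := P.D₀_bounds.2
    have hXL : (16 : ℝ) ≤ (P.X : ℝ) * P.L := by nlinarith [P.X_floors.2.1]
    linarith
  have hs : (16 : ℝ) * ((n : ℝ) + 1) * P.L ≤ ((P.S₀ : ℝ) + 1) * ((n : ℝ) + 2) ^ 4 := by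
    have h := P.M_lt_S₀_succ_mul
    have h' : ((16 * (n + 1) * P.L : ℕ) : ℝ) < (((P.S₀ + 1) * (n + 2) ^ 4 : ℕ) : ℝ) := by exact_mod_cast h
    push_cast at h'; linarith
  have hρ' : 2 * ((K n : ℝ) * P.N * P.L / 2 ^ P.Sd) ≤ (P.L : ℝ) / 2 ^ (n + 22) := by
    have e : (P.L : ℝ) / 2 ^ (n + 22) = 2 * ((P.L : ℝ) / 2 ^ (n + 23)) := by
      rw [show (2 : ℝ) ^ (n + 23) = 2 ^ (n + 22) * 2 by ring]; field_simp
    rw [e]; linarith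
  exact RecordExits.exitC_capped hA1 hD1 hD (by linarith) hρ' hX64 P.end_floors.1 hD₀half P.D₀_le_XKΩ hs
    (P.Xfin_sharp hn2).le P.three_L_le (two_pow_le_CbK (by omega))

end ArchG3Rec

end Summit.ABC.StewartYu

end
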